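import Summits.CriticalPhenomena.Ising3D.ExclusionSentences

/-!
# The in-print catalogue as a corollary schema of a windowed enclosure (cell `pub-ising3x`, recog-1)

HONEST FRAMING: lottery ticket; floor = tightest certified 3D Ising CFT bounds; no exact-solution
claim without a proof.

SCOPE.md §6 (lead v2.2–v2.5) fixes what the floor's cheapest rung prints about the closed forms
proposed in print for `(Δ_σ, Δ_ε)` (family `NAMED` of FAMILIES-v1, data in `ExclusionSentences.lean`):
under `IsingEnclosure W R` with `R` inside a rational box `[a, b] × [c, d]`, every in-window NAMED
value is refuted as soon as the box's faces pass it — `Δ_ε ∉ {7/5, 13/9, 3/2}` needs `7/5 < c` and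
`d < 13/9`; `Δ_σ ≠ 19/36` needs `b < 19/36`; Ghosh's `Δ_σ = 899/1728` alone needs `b < 899/1728`
(the `Λ = 15` rung's design target); `Δ_σ = 15/31` falls by A1 with no certificate
(`deltaSigma_ne_fifteen_div_thirtyOne`). This file states exactly those corollaries with the
THRESHOLDS AS HYPOTHESES on `a, b, c, d` — no region is posited, no digit is used; phase 1 supplies
`h : IsingEnclosure W R` from a two-verifier certificate and discharges the thresholds by `norm_num`.

Honesty clause (SCOPE §6 v2.5): each sentence quantifies over admissible data WITH `(Δ_σ, Δ_ε) ∈ W`;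
for a pair `v ∉ W` the pair sentence merely restates the window hypothesis, so the paper lists such
pairs ((9/16, 3/2), (1/2, 7/5), (3/5, 7/5)) under "outside the certified window", never as refuted by
the enclosure — their refutation is a ONE-BOX statement `BoxExcluded Q ∋ v`
(`point_not_attained_of_boxExcluded`).
-/

namespace Summit.CriticalPhenomena.Ising3D

open Literature.MathematicalPhysics.QuantumFieldTheory.ConformalBootstrap3D

/-- If the `Δ_σ`-projection of `R` is bounded above by `b < x`, no admissible datum in the window has
`Δ_σ = x`. -/
theorem sigma_ne_of_lt_of_isingEnclosure {W R : Set (ℝ × ℝ)} (h : IsingEnclosure W R) {b : ℚ}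
    (hR : ∀ q ∈ R, q.1 ≤ (b : ℝ)) {x : ℝ} (hx : (b : ℝ) < x) (D : SigmaEpsilonData)
    (hD : D.SatisfiesBootstrapAxioms) (hW : (D.Δσ, D.Δε) ∈ W) : D.Δσ ≠ x :=
  sigma_ne_of_isingEnclosure h (fun q hq e => absurd (e ▸ hR q hq) (not_le.mpr hx)) D hD hW

/-- If the `Δ_ε`-projection of `R` is bounded below by `c > y`, no admissible datum in the window has
`Δ_ε = y`. -/
theorem eps_ne_of_gt_of_isingEnclosure {W R : Set (ℝ × ℝ)} (h : IsingEnclosure W R) {c : ℚ}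
    (hR : ∀ q ∈ R, (c : ℝ) ≤ q.2) {y : ℝ} (hy : y < (c : ℝ)) (D : SigmaEpsilonData)
    (hD : D.SatisfiesBootstrapAxioms) (hW : (D.Δσ, D.Δε) ∈ W) : D.Δε ≠ y :=
  eps_ne_of_isingEnclosure h (fun q hq e => absurd (e ▸ hR q hq) (not_le.mpr hy)) D hD hW

/-- If the `Δ_ε`-projection of `R` is bounded above by `d < y`, no admissible datum in the window has
`Δ_ε = y`. -/
theorem eps_ne_of_lt_of_isingEnclosure {W R : Set (ℝ × ℝ)} (h : IsingEnclosure W R) {d : ℚ}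
    (hR : ∀ q ∈ R, q.2 ≤ (d : ℝ)) {y : ℝ} (hy : (d : ℝ) < y) (D : SigmaEpsilonData)
    (hD : D.SatisfiesBootstrapAxioms) (hW : (D.Δσ, D.Δε) ∈ W) : D.Δε ≠ y :=
  eps_ne_of_isingEnclosure h (fun q hq e => absurd (e ▸ hR q hq) (not_le.mpr hy)) D hD hW

/-- **The `Δ_ε` line of the catalogue.** Under `IsingEnclosure W R` with the `Δ_ε`-projection of `R`
inside `[c, d]`, `7/5 < c` and `d < 13/9`: every admissible datum in the window has
`Δ_ε ∉ {7/5, 13/9, 3/2}` — the `Δ_ε`-projections of ALL closed-form proposals in print (series-era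
set A and Mojumder 1991: `ν = 5/8`; Fisher–Burford 1967: `ν = 9/14`; Zhang 2007 / Kaupužs 2001 /
Ghosh 2026: `ν = 2/3`), i.e. `∀ v ∈ namedEps, Δ_ε ≠ v`. -/
theorem namedEps_refuted_of_isingEnclosure {W R : Set (ℝ × ℝ)} (h : IsingEnclosure W R) {c d : ℚ}
    (hR : ∀ q ∈ R, (c : ℝ) ≤ q.2 ∧ q.2 ≤ (d : ℝ)) (hc : 7 / 5 < c) (hd : d < 13 / 9)
    (D : SigmaEpsilonData) (hD : D.SatisfiesBootstrapAxioms) (hW : (D.Δσ, D.Δε) ∈ W) :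
    ∀ v ∈ namedEps, D.Δε ≠ (v : ℝ) := by
  have hc' : ((7 / 5 : ℚ) : ℝ) < c := by exact_mod_cast hc
  have hd' : (d : ℝ) < ((13 / 9 : ℚ) : ℝ) := by exact_mod_cast hd
  have hd2 : (d : ℝ) < ((3 / 2 : ℚ) : ℝ) := by
    have : (d : ℚ) < 3 / 2 := by linarith
    exact_mod_cast this
  intro v hv
  simp only [namedEps, List.mem_cons, List.not_mem_nil, or_false] at hv
  rcases hv with rfl | rfl | rfl
  · exact eps_ne_of_lt_of_isingEnclosure h (fun q hq => (hR q hq).2) hd2 D hD hW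
  · exact eps_ne_of_gt_of_isingEnclosure h (fun q hq => (hR q hq).1) hc' D hD hW
  · exact eps_ne_of_lt_of_isingEnclosure h (fun q hq => (hR q hq).2) hd' D hD hW

/-- **The `Δ_σ = 19/36` line** (Fisher–Burford 1967 reading `η = 1/18`): refuted under any enclosure
whose `Δ_σ`-projection stays below `19/36`. -/
theorem sigma_ne_nineteen_div_thirtySix_of_isingEnclosure {W R : Set (ℝ × ℝ)}
    (h : IsingEnclosure W R) {b : ℚ} (hR : ∀ q ∈ R, q.1 ≤ (b : ℝ)) (hb : b < 19 / 36)
    (D : SigmaEpsilonData) (hD : D.SatisfiesBootstrapAxioms) (hW : (D.Δσ, D.Δε) ∈ W) :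
    D.Δσ ≠ 19 / 36 := by
  have hb' : (b : ℝ) < 19 / 36 := by
    rw [show (19 / 36 : ℝ) = ((19 / 36 : ℚ) : ℝ) by norm_num]; exact_mod_cast hb
  exact sigma_ne_of_lt_of_isingEnclosure h hR hb' D hD hW

/-- **Ghosh's `Δ_σ = 899/1728` alone** (arXiv:2607.10865, `η = 35/864`; quarantined NAMED-late-1):
refuted under any enclosure whose `Δ_σ`-projection stays below `899/1728 = 0.520254…` — the `Λ = 15`
rung's design target of SCOPE §6 v2.4 (certified upper `Δ_σ` face `≤ 0.5200`), not the pre-F0 rung. -/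
theorem sigma_ne_ghosh_of_isingEnclosure {W R : Set (ℝ × ℝ)} (h : IsingEnclosure W R) {b : ℚ}
    (hR : ∀ q ∈ R, q.1 ≤ (b : ℝ)) (hb : b < 899 / 1728) (D : SigmaEpsilonData)
    (hD : D.SatisfiesBootstrapAxioms) (hW : (D.Δσ, D.Δε) ∈ W) : D.Δσ ≠ 899 / 1728 := by
  have hb' : (b : ℝ) < 899 / 1728 := by
    rw [show (899 / 1728 : ℝ) = ((899 / 1728 : ℚ) : ℝ) by norm_num]; exact_mod_cast hb
  exact sigma_ne_of_lt_of_isingEnclosure h hR hb' D hD hW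

/-- **Pairs.** Every pair of `namedPairs` has `Δ_ε`-coordinate in `namedEps`, so under the
hypotheses of `namedEps_refuted_of_isingEnclosure` no admissible datum in the window sits at any of
them. CONTENT only for the pairs inside `W` (for the pre-F0 window: `(19/36, 13/9)`,
`(899/1728, 3/2)`); for pairs outside `W` this restates the window hypothesis (SCOPE §6 v2.5) and the
paper says so. -/
theorem namedPairs_not_attained_of_isingEnclosure {W R : Set (ℝ × ℝ)} (h : IsingEnclosure W R)
    {c d : ℚ} (hR : ∀ q ∈ R, (c : ℝ) ≤ q.2 ∧ q.2 ≤ (d : ℝ)) (hc : 7 / 5 < c) (hd : d < 13 / 9)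
    (D : SigmaEpsilonData) (hD : D.SatisfiesBootstrapAxioms) (hW : (D.Δσ, D.Δε) ∈ W) :
    ∀ v ∈ namedPairs, (D.Δσ, D.Δε) ≠ ((v.1 : ℝ), (v.2 : ℝ)) := by
  intro v hv e
  have hε : D.Δε = (v.2 : ℝ) := congrArg Prod.snd e
  have hmem : v.2 ∈ namedEps := by
    simp only [namedPairs, List.mem_cons, List.not_mem_nil, or_false] at hv
    rcases hv with rfl | rfl | rfl | rfl | rfl <;> simp [namedEps]
  exact namedEps_refuted_of_isingEnclosure h hR hc hd D hD hW v.2 hmem hε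

/-- **The pre-F0 catalogue in one statement** (SCOPE §6 v2.5 "IN W ⇒ certified-refutable" plus
"BELOW A1"): under `IsingEnclosure W R` with `R ⊆ [a, b] × [c, d]`, `b < 19/36`, `7/5 < c`,
`d < 13/9`, every admissible datum in the window has `Δ_σ ∉ {19/36, 15/31}` and
`Δ_ε ∉ {7/5, 13/9, 3/2}`. -/
theorem preF0_catalogue_of_isingEnclosure {W R : Set (ℝ × ℝ)} (h : IsingEnclosure W R)
    {a b c d : ℚ} (hR : ∀ q ∈ R, ((a : ℝ) ≤ q.1 ∧ q.1 ≤ (b : ℝ)) ∧ ((c : ℝ) ≤ q.2 ∧ q.2 ≤ (d : ℝ)))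
    (hb : b < 19 / 36) (hc : 7 / 5 < c) (hd : d < 13 / 9) (D : SigmaEpsilonData)
    (hD : D.SatisfiesBootstrapAxioms) (hW : (D.Δσ, D.Δε) ∈ W) :
    (D.Δσ ≠ 19 / 36 ∧ D.Δσ ≠ 15 / 31) ∧ (D.Δε ≠ 7 / 5 ∧ D.Δε ≠ 13 / 9 ∧ D.Δε ≠ 3 / 2) := by
  have hE := namedEps_refuted_of_isingEnclosure h (fun q hq => (hR q hq).2) hc hd D hD hW
  refine ⟨⟨sigma_ne_nineteen_div_thirtySix_of_isingEnclosure h (fun q hq => (hR q hq).1.2) hb D hD hW,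
    deltaSigma_ne_fifteen_div_thirtyOne D hD⟩, ?_, ?_, ?_⟩
  · have := hE (7 / 5) (by simp [namedEps])
    rwa [show ((7 / 5 : ℚ) : ℝ) = 7 / 5 by norm_num] at this
  · have := hE (13 / 9) (by simp [namedEps])
    rwa [show ((13 / 9 : ℚ) : ℝ) = 13 / 9 by norm_num] at this
  · have := hE (3 / 2) (by simp [namedEps])
    rwa [show ((3 / 2 : ℚ) : ℝ) = 3 / 2 by norm_num] at this

end Summit.CriticalPhenomena.Ising3D
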